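import Literature.MathematicalPhysics.QuantumChemistry.SpinClassNecessaryConditions
import Literature.MathematicalPhysics.QuantumLattice.FermionQuasiFree
import HarnessLib

/-!
# The rank-2 (spin-quadrupole) NULLITY rows of a doublet 2-RDM: a necessary condition for the spin
# class `S = M = ½`

Topic `Literature/MathematicalPhysics/QuantumChemistry`; companion of `RDMSpinSectorConditions.lean`
(the `S_z` structure and the `S`-representability SUM RULE (98) of Mazziotti 2007 §II.F.1) and of
`SpinClassNecessaryConditions.lean` (`IsNecessaryInSpinClass a b C`: conditions that hold at the RDM pair
of every unit vector of the `(N_α, N_β) = (a, b)` sector annihilated by `Ŝ_+`, i.e. of total spin exactly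
`S = M = (a − b)/2`). This file adds a family of LINEAR EQUALITY rows on the 2-RDM that is necessary for
the DOUBLET class (`a = b + 1`, `S = M = ½`) and is NOT a consequence of the `S_z` structure or of the sum
rule: the rank-2 spin-tensor component of the 2-RDM vanishes.

THE STATEMENT. Helgaker–Jørgensen–Olsen (2000) §2.3.1 define a spin tensor operator of rank `S` by
`[Ŝ_±, T^{S,M}] = √(S(S+1) − M(M±1)) T^{S,M±1}` (2.3.1), `[Ŝ_z, T^{S,M}] = M T^{S,M}` (2.3.2),
`T^{S,S+1} = T^{S,−S−1} = 0` (2.3.3), and §2.3.2 eqs. (2.3.12)–(2.3.14) record that the creation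
operators `{a†_{pα}, a†_{pβ}}` and the annihilators `{−a_{pβ}, a_{pα}}` are DOUBLET tensor operators:
`[Ŝ_+, a†_{pβ}] = a†_{pα}`, `[Ŝ_+, a†_{pα}] = 0`, `[Ŝ_+, a_{pα}] = −a_{pβ}`, `[Ŝ_+, a_{pβ}] = 0`
(§1 below, from the CAR). The two-pair string `X = a†_{pβ} a†_{qβ} a_{sα} a_{rα}` is the `M = −2`
component of the rank-2 tensor in (doublet)^{⊗4}; its double commutator
`ad²_{Ŝ_+} X = Ŝ_+(Ŝ_+X − XŜ_+) − (Ŝ_+X − XŜ_+)Ŝ_+` is (twice) the `M = 0` rank-2 component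
  `q̂₂(pq, rs) = a†_{pα}a†_{qα}a_{sα}a_{rα} + a†_{pβ}a†_{qβ}a_{sβ}a_{rβ} − a†_{pα}a†_{qβ}a_{sβ}a_{rα}
      − a†_{pα}a†_{qβ}a_{sα}a_{rβ} − a†_{pβ}a†_{qα}a_{sβ}a_{rα} − a†_{pβ}a†_{qα}a_{sα}a_{rβ}`
(§2, pure ring algebra from the four commutators — `doubleCommutator_fourString`). In a state `ψ` with
`Ŝ_+ψ = 0` AND `Ŝ_−²ψ = 0` every double `ad_{Ŝ_+}`-descendant has zero expectation (§3,
`expect_doubleCommutator_spinPlus_eq_zero`: `⟨ψ, Ŝ_+Ŝ_+Xψ⟩ = ⟨Ŝ_−Ŝ_−ψ, Xψ⟩`); a unit vector of the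
doublet sector `(b+1, b)` annihilated by `Ŝ_+` satisfies `Ŝ_−²ψ = 0` (§4,
`spinMinus_spinMinus_mulVec_eq_zero_of_doublet`: `Ŝ_+Ŝ_−ψ = ψ` and `Ŝ_+Ŝ_−(Ŝ_−ψ) = 0` from
`[Ŝ_+, Ŝ_−] = 2Ŝ_z`, so `‖Ŝ_−²ψ‖² = ⟨Ŝ_−ψ, Ŝ_+Ŝ_−²ψ⟩ = 0` — the multiplet `S = ½` has only `M = ±½`).
Hence (§5) the ROWS on the 2-RDM `²D^{ij}_{kl} = ⟨ψ|a†_i a†_j a_l a_k|ψ⟩` of every such `ψ`, for all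
spatial `p, q, r, s`:
  `²D^{pα qα}_{rα sα} + ²D^{pβ qβ}_{rβ sβ} − ²D^{pα qβ}_{rα sβ} − ²D^{pα qβ}_{rβ sα} − ²D^{pβ qα}_{rα sβ}
      − ²D^{pβ qα}_{rβ sα} = 0`
(`twoRDM_rankTwo_nullity_of_doublet`), packaged as `isNecessaryInSpinClass_rankTwoNullity b :
IsNecessaryInSpinClass (b+1) b (…)` — the angular-momentum selection rule `½ ⊗ 2 ∌ ½` (Wigner–Eckart)
for this rank-2 operator, proved here from first principles. The diagonal trace of the family is
`−⟨Ŝ_−Ŝ_+⟩`, i.e. the sum rule (98) at `S = M` is one linear combination of these rows (not restated).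
Context: the «`S`-representability problem» — conditions a `p`-RDM must fulfil to derive from a state
with well-defined `Ŝ²` and `Ŝ_z`, eqs. (21)–(22) of D. R. Alcoba's chapter in the same volume (held copy
`book:editornd-reduced-density-matrix-mechanics` p. 222, §II.C), studied there through the spin
structure of the `G`-matrices; the rows below are one explicit, linear, `S = ½`-specific member of that
condition set.

WHY (cell chem-oracle, 2026-08-30): these are the «Q2» rows of the RANK-1 relaxation-repair byte
K14-PIN-R1 (chem-k14-lens-3 LENS-3-NODE-v3, kernel-checked there over an ABSTRACT ring only —
`LENS-3g3-SpinQuadrupoleNullity.lean`; chem-k14-instr-1 INSTRUMENT-SPEC-v1 §2: 1 073 independent rows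
appended to the boxed `DQGT1T2′` relaxation of the `(10, 9)` sector of T01a). A certified `L′` of that
programme bounds the DOUBLET-CLASS energy `E₀(H_F; N = 19, S = ½)` iff every appended row is
class-necessary; this file is the typed necessity of the Q2 family over the tree's Fock-space objects
(the F2b family's is `Summits/…/Rows/SpinClassRows.lean` `isNecessaryInSpinClass_maximalProjection`).
Everything is PROVED (0 sorry); no definitions, no named facts. HONEST FRAMING: kernel algebra about
the fermionic Fock space of finitely many spin orbitals; nothing about any molecule or material.
WHAT IS NOT HERE: the singlet case (`a = b`, where `Ŝ_−ψ = 0` makes the rows hold trivially term by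
term up to the `S_z` structure), higher-rank nullities for `S ≥ 1`, and any SDP.
-/

noncomputable section

namespace Literature.MathematicalPhysics.QuantumChemistry

open Matrix Finset Literature.MathematicalPhysics.QuantumLattice
open scoped ComplexOrder

variable {Λ : Type*} [LinearOrder Λ] [Fintype Λ]

/-! ## §1 `Ŝ_+` acts on the elementary operators as on doublets (HJO (2.3.12)–(2.3.14)) -/

/-- In `Fin 2`, `1 ≠ 0` as a rewriting rule for the spin labels `α = 0`, `β = 1`. [folklore] -/
private theorem fin_one_eq_zero_iff : ((1 : Fin 2) = 0) ↔ False := by decide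

/-- In `Fin 2`, `0 ≠ 1` as a rewriting rule for the spin labels. [folklore] -/
private theorem fin_zero_eq_one_iff : ((0 : Fin 2) = 1) ↔ False := by decide

/-- **`[Ŝ_+, a†_{pβ}] = a†_{pα}`**: the creation operators `{a†_{pα}, a†_{pβ}}` form a doublet tensor
operator, lower component raised by `Ŝ_+ = Σ_x a†_{xα} a_{xβ}` (from the CAR
`[a†_i a_l, a†_j] = δ_{lj} a†_i`). [cite: HelgakerJorgensenOlsen2000, §2.3.2 eq. (2.3.12)] -/
theorem spinPlus_mul_creation_down_sub (p : Λ) :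
    (spinPlus : Matrix (Finset (Orb Λ)) (Finset (Orb Λ)) ℂ) * creation (orb p 1) -
        creation (orb p 1) * spinPlus = creation (orb p 0) := by
  simp only [spinPlus, Finset.sum_mul, Finset.mul_sum, ← Finset.sum_sub_distrib,
    creation_mul_annihilation_commutator_creation, orb_inj, and_true, Finset.sum_ite_eq',
    Finset.mem_univ, if_true]

/-- **`[Ŝ_+, a†_{pα}] = 0`**: the upper doublet component is annihilated by the raising operator
(HJO (2.3.12) with `m_s = ½`, the square root vanishing). [cite: HelgakerJorgensenOlsen2000, §2.3.2 eq. (2.3.12)] -/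
theorem spinPlus_mul_creation_up_sub (p : Λ) :
    (spinPlus : Matrix (Finset (Orb Λ)) (Finset (Orb Λ)) ℂ) * creation (orb p 0) -
        creation (orb p 0) * spinPlus = 0 := by
  simp only [spinPlus, Finset.sum_mul, Finset.mul_sum, ← Finset.sum_sub_distrib,
    creation_mul_annihilation_commutator_creation, orb_inj, fin_one_eq_zero_iff, and_false,
    if_false, Finset.sum_const_zero]

/-- **`[Ŝ_+, a_{pα}] = −a_{pβ}`**: the annihilators `{−a_{pβ}, a_{pα}}` form a doublet tensor operator
(HJO (2.3.14): `b_{pα} = −a_{pβ}`, `b_{pβ} = a_{pα}`, and `[Ŝ_+, b_{pβ}] = b_{pα}`; from the CAR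
`[a†_i a_l, a_j] = −δ_{ij} a_l`). [cite: HelgakerJorgensenOlsen2000, §2.3.2 eqs. (2.3.12)-(2.3.14)] -/
theorem spinPlus_mul_annihilation_up_sub (p : Λ) :
    (spinPlus : Matrix (Finset (Orb Λ)) (Finset (Orb Λ)) ℂ) * annihilation (orb p 0) -
        annihilation (orb p 0) * spinPlus = -annihilation (orb p 1) := by
  simp only [spinPlus, Finset.sum_mul, Finset.mul_sum, ← Finset.sum_sub_distrib,
    creation_mul_annihilation_commutator_annihilation, orb_inj, and_true, Finset.sum_ite_eq',
    Finset.mem_univ, if_true]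

/-- **`[Ŝ_+, a_{pβ}] = 0`**: the upper component `b_{pβ} = a_{pα}`… rather, `a_{pβ} = −b_{pα}` is the
TOP component of the annihilator doublet and is killed by `Ŝ_+` (HJO (2.3.12)–(2.3.14)).
[cite: HelgakerJorgensenOlsen2000, §2.3.2 eqs. (2.3.12)-(2.3.14)] -/
theorem spinPlus_mul_annihilation_down_sub (p : Λ) :
    (spinPlus : Matrix (Finset (Orb Λ)) (Finset (Orb Λ)) ℂ) * annihilation (orb p 1) -
        annihilation (orb p 1) * spinPlus = 0 := by
  simp only [spinPlus, Finset.sum_mul, Finset.mul_sum, ← Finset.sum_sub_distrib,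
    creation_mul_annihilation_commutator_annihilation, orb_inj, fin_zero_eq_one_iff, and_false,
    if_false, Finset.sum_const_zero]

/-! ## §2 The double commutator of a two-pair string (ring algebra) -/

/-- **`ad²_S (b₁ b₂ c₁ c₂) = 2 q̂₂`** in any ring: if `S` raises `b_i ↦ a_i ↦ 0` and `c_i ↦ −d_i ↦ 0`
under commutation (`[S, b_i] = a_i`, `[S, a_i] = 0`, `[S, c_i] = −d_i`, `[S, d_i] = 0` — two creation
doublets and two annihilation doublets, HJO (2.3.12)–(2.3.14)), then
`S(SX − XS) − (SX − XS)S = 2 • (a₁a₂c₁c₂ + b₁b₂d₁d₂ − a₁b₂d₁c₂ − a₁b₂c₁d₂ − b₁a₂d₁c₂ − b₁a₂c₁d₂)` for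
`X = b₁b₂c₁c₂` (applying (2.3.1) twice to the `M = −2` component of the coupled rank-2 tensor lands on
its `M = 0` component; here by direct expansion). [cite: HelgakerJorgensenOlsen2000, §2.3.1 eqs. (2.3.1)-(2.3.3)] -/
theorem doubleCommutator_fourString {A : Type*} [Ring A] (S b₁ b₂ c₁ c₂ a₁ a₂ d₁ d₂ : A)
    (hb₁ : S * b₁ - b₁ * S = a₁) (hb₂ : S * b₂ - b₂ * S = a₂) (ha₁ : S * a₁ - a₁ * S = 0)
    (ha₂ : S * a₂ - a₂ * S = 0) (hc₁ : S * c₁ - c₁ * S = -d₁) (hc₂ : S * c₂ - c₂ * S = -d₂)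
    (hd₁ : S * d₁ - d₁ * S = 0) (hd₂ : S * d₂ - d₂ * S = 0) :
    S * (S * (b₁ * b₂ * c₁ * c₂) - b₁ * b₂ * c₁ * c₂ * S) -
        (S * (b₁ * b₂ * c₁ * c₂) - b₁ * b₂ * c₁ * c₂ * S) * S =
      2 • (a₁ * a₂ * c₁ * c₂ + b₁ * b₂ * d₁ * d₂ - a₁ * b₂ * d₁ * c₂ - a₁ * b₂ * c₁ * d₂ -
        b₁ * a₂ * d₁ * c₂ - b₁ * a₂ * c₁ * d₂) := by
  -- the eight commutators as «move `S` to the right» rewriting rules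
  have ea₁ : a₁ = S * b₁ - b₁ * S := hb₁.symm
  have ea₂ : a₂ = S * b₂ - b₂ * S := hb₂.symm
  have ed₁ : d₁ = -(S * c₁ - c₁ * S) := by rw [hc₁, neg_neg]
  have ed₂ : d₂ = -(S * c₂ - c₂ * S) := by rw [hc₂, neg_neg]
  have sa₁ : S * a₁ = a₁ * S := sub_eq_zero.1 ha₁
  have sa₂ : S * a₂ = a₂ * S := sub_eq_zero.1 ha₂
  have sd₁ : S * d₁ = d₁ * S := sub_eq_zero.1 hd₁
  have sd₂ : S * d₂ = d₂ * S := sub_eq_zero.1 hd₂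
  have rb₁ : ∀ Z, S * (b₁ * Z) = b₁ * (S * Z) + a₁ * Z := fun Z => by rw [ea₁]; noncomm_ring
  have rb₂ : ∀ Z, S * (b₂ * Z) = b₂ * (S * Z) + a₂ * Z := fun Z => by rw [ea₂]; noncomm_ring
  have ra₁ : ∀ Z, S * (a₁ * Z) = a₁ * (S * Z) := fun Z => by rw [← mul_assoc, sa₁, mul_assoc]
  have ra₂ : ∀ Z, S * (a₂ * Z) = a₂ * (S * Z) := fun Z => by rw [← mul_assoc, sa₂, mul_assoc]
  have rc₁ : ∀ Z, S * (c₁ * Z) = c₁ * (S * Z) - d₁ * Z := fun Z => by rw [ed₁]; noncomm_ring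
  have rc₂ : ∀ Z, S * (c₂ * Z) = c₂ * (S * Z) - d₂ * Z := fun Z => by rw [ed₂]; noncomm_ring
  have rd₁ : ∀ Z, S * (d₁ * Z) = d₁ * (S * Z) := fun Z => by rw [← mul_assoc, sd₁, mul_assoc]
  have rd₂ : ∀ Z, S * (d₂ * Z) = d₂ * (S * Z) := fun Z => by rw [← mul_assoc, sd₂, mul_assoc]
  have tc₂ : S * c₂ = c₂ * S - d₂ := by rw [ed₂]; noncomm_ring
  simp only [mul_sub, sub_mul, mul_assoc, rb₁, rb₂, ra₁, ra₂, rc₁, rc₂, rd₁, mul_add, add_mul,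
    tc₂, sd₂]
  noncomm_ring

/-! ## §3 Double `ad_{Ŝ_+}`-descendants have zero expectation when `Ŝ_+ψ = 0` and `Ŝ_−²ψ = 0` -/

/-- `⟨ψ| ⋯ Ŝ_+` as a bra: `ψ† Ŝ_+ = (Ŝ_− ψ)†` (`Ŝ_− = Ŝ_+†`). [folklore] -/
private theorem star_vecMul_spinPlus (v : Fock (Orb Λ)) :
    star v ᵥ* (spinPlus : Matrix (Finset (Orb Λ)) (Finset (Orb Λ)) ℂ) = star (spinMinus *ᵥ v) := by
  rw [star_mulVec, spinMinus, conjTranspose_conjTranspose]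

/-- **Double `ad_{Ŝ_+}`-descendants vanish in expectation** for a vector with `Ŝ_+ψ = 0` (highest
weight) and `Ŝ_−(Ŝ_−ψ) = 0` (what `S = ½` adds to `M = ½`): for every operator `X`,
`⟨ψ| Ŝ_+(Ŝ_+X − XŜ_+) − (Ŝ_+X − XŜ_+)Ŝ_+ |ψ⟩ = ⟨ψ|Ŝ_+Ŝ_+X|ψ⟩ − 2⟨ψ|Ŝ_+XŜ_+|ψ⟩ + ⟨ψ|XŜ_+Ŝ_+|ψ⟩ = 0`
(the first term is `⟨Ŝ_−Ŝ_−ψ, Xψ⟩`). With HJO (2.3.1) this is the statement that the `M`-component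
reached by two raising steps has no diagonal matrix element in such a state.
[cite: HelgakerJorgensenOlsen2000, §2.3.1 eqs. (2.3.1)-(2.3.6)] -/
theorem expect_doubleCommutator_spinPlus_eq_zero {ψ : Fock (Orb Λ)} (hP : spinPlus *ᵥ ψ = 0)
    (hM2 : spinMinus *ᵥ (spinMinus *ᵥ ψ) = 0) (X : Matrix (Finset (Orb Λ)) (Finset (Orb Λ)) ℂ) :
    star ψ ⬝ᵥ (spinPlus * (spinPlus * X - X * spinPlus) - (spinPlus * X - X * spinPlus) * spinPlus) *ᵥ
      ψ = 0 := by
  simp only [mul_sub, sub_mul, Matrix.sub_mulVec, ← Matrix.mulVec_mulVec, hP, Matrix.mulVec_zero,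
    sub_zero]
  rw [dotProduct_mulVec, star_vecMul_spinPlus, dotProduct_mulVec, star_vecMul_spinPlus, hM2,
    star_zero, zero_dotProduct]

/-! ## §4 A doublet highest-weight vector is killed by `Ŝ_−²` -/

/-- `Ŝ_+Ŝ_− = Ŝ_−Ŝ_+ + 2Ŝ_z` (the tree's `[Ŝ_+, Ŝ_−] = 2Ŝ_z`, `LiebThm1.spinPlus_mul_spinMinus_sub`).
Tasaki (2020) §9.3 (9.3.6); HJO §2.2 (2.2.38)/(2.3.6). [cite: HelgakerJorgensenOlsen2000, §2.3.1 eq. (2.3.6)] -/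
theorem spinPlus_mul_spinMinus_eq_add :
    (spinPlus * spinMinus : Matrix (Finset (Orb Λ)) (Finset (Orb Λ)) ℂ) =
      spinMinus * spinPlus + (2 : ℂ) • HubbardWave0.spinZ := by
  have h := LiebThm1.spinPlus_mul_spinMinus_sub (Λ := Λ)
  rw [sub_eq_iff_eq_add'] at h
  exact h

/-- **`Ŝ_−²ψ = 0` on the doublet class.** For `ψ` in the sector `(b+1, b)` (`M = ½`) with `Ŝ_+ψ = 0`
(so `S = ½`): `Ŝ_−(Ŝ_−ψ) = 0` — the multiplet has only the components `M = ±½`. Proof from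
`[Ŝ_+, Ŝ_−] = 2Ŝ_z`: `Ŝ_+Ŝ_−ψ = 2Mψ = ψ`, and for `φ = Ŝ_−ψ` (sector `(b, b+1)`, `M = −½`)
`Ŝ_+Ŝ_−φ = Ŝ_−Ŝ_+φ − φ = Ŝ_−ψ − φ = 0`, whence `‖Ŝ_−φ‖² = ⟨φ, Ŝ_+Ŝ_−φ⟩ = 0`. HJO (2.3.3)–(2.3.4)
(`T^{S,−S−1} = 0`) at `S = ½`. [cite: HelgakerJorgensenOlsen2000, §2.3.1 eqs. (2.3.3)-(2.3.4)] -/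
theorem spinMinus_spinMinus_mulVec_eq_zero_of_doublet {b : ℕ} {ψ : Fock (Orb Λ)}
    (hψ : IsInSector (b + 1) b ψ) (hP : spinPlus *ᵥ ψ = 0) :
    spinMinus *ᵥ (spinMinus *ᵥ ψ) = 0 := by
  have hφs : IsInSector b (b + 1) (spinMinus *ᵥ ψ) :=
    LiebThm1.lowersSpin_spinMinus.isInSector_mulVec hψ
  have h1 : spinPlus *ᵥ (spinMinus *ᵥ ψ) = ψ := by
    rw [mulVec_mulVec, spinPlus_mul_spinMinus_eq_add, add_mulVec, ← mulVec_mulVec, hP, mulVec_zero,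
      zero_add, Matrix.smul_mulVec, LiebThm1.spinZ_mulVec_of_isInSector hψ, smul_smul]
    have hc : (2 : ℂ) * (1 / 2 * (((b + 1 : ℕ) : ℂ) - (b : ℂ))) = 1 := by push_cast; ring
    rw [hc, one_smul]
  have h2 : spinPlus *ᵥ (spinMinus *ᵥ (spinMinus *ᵥ ψ)) = 0 := by
    rw [mulVec_mulVec, spinPlus_mul_spinMinus_eq_add, add_mulVec, ← mulVec_mulVec, h1,
      Matrix.smul_mulVec, LiebThm1.spinZ_mulVec_of_isInSector hφs, smul_smul]
    have hc : (2 : ℂ) * (1 / 2 * ((b : ℂ) - ((b + 1 : ℕ) : ℂ))) = -1 := by push_cast; ring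
    rw [hc, neg_one_smul, add_neg_cancel]
  have h3 : star (spinMinus *ᵥ (spinMinus *ᵥ ψ)) ⬝ᵥ (spinMinus *ᵥ (spinMinus *ᵥ ψ)) = 0 := by
    have hadj : (spinMinus : Matrix (Finset (Orb Λ)) (Finset (Orb Λ)) ℂ)ᴴ = spinPlus := by
      rw [spinMinus, conjTranspose_conjTranspose]
    rw [star_mulVec, hadj, ← dotProduct_mulVec, h2, dotProduct_zero]
  exact dotProduct_star_self_eq_zero.1 h3

/-! ## §5 The rank-2 nullity rows on the 2-RDM and their class-necessity -/

/-- **THE RANK-2 NULLITY ROWS OF A DOUBLET 2-RDM.** For `ψ` in the sector `(b+1, b)` with `Ŝ_+ψ = 0`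
(total spin exactly `½`) and all spatial `p, q, r, s` (`²D^{ij}_{kl} = ⟨ψ|a†_i a†_j a_l a_k|ψ⟩`, `α = 0`,
`β = 1`):
`²D^{pα qα}_{rα sα} + ²D^{pβ qβ}_{rβ sβ} − ²D^{pα qβ}_{rα sβ} − ²D^{pα qβ}_{rβ sα} − ²D^{pβ qα}_{rα sβ}
  − ²D^{pβ qα}_{rβ sα} = 0`
— the `M = 0` component of the rank-2 spin tensor carried by two pair operators has zero expectation
in an `S = ½` state (`½ ⊗ 2 ∌ ½`): `⟨ψ| ad²_{Ŝ_+}(a†_{pβ}a†_{qβ}a_{sα}a_{rα}) |ψ⟩ = 0` by §3–§4 and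
`ad²_{Ŝ_+}(…) = 2 q̂₂(pq, rs)` by §1–§2. (The «Q2» rows of the chem-oracle RANK-1 byte; their diagonal
trace is `−⟨Ŝ_−Ŝ_+⟩`, Mazziotti's sum rule (98) at `S = M`.)
[cite: HelgakerJorgensenOlsen2000, §2.3.1 eqs. (2.3.1)-(2.3.6)] -/
theorem twoRDM_rankTwo_nullity_of_doublet {b : ℕ} {ψ : Fock (Orb Λ)} (hψ : IsInSector (b + 1) b ψ)
    (hP : spinPlus *ᵥ ψ = 0) (p q r s : Λ) :
    twoRDM ψ (orb p 0, orb q 0) (orb r 0, orb s 0) + twoRDM ψ (orb p 1, orb q 1) (orb r 1, orb s 1) -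
        twoRDM ψ (orb p 0, orb q 1) (orb r 0, orb s 1) - twoRDM ψ (orb p 0, orb q 1) (orb r 1, orb s 0) -
        twoRDM ψ (orb p 1, orb q 0) (orb r 0, orb s 1) - twoRDM ψ (orb p 1, orb q 0) (orb r 1, orb s 0) =
      0 := by
  have hop := doubleCommutator_fourString (spinPlus : Matrix (Finset (Orb Λ)) (Finset (Orb Λ)) ℂ)
    (creation (orb p 1)) (creation (orb q 1)) (annihilation (orb s 0)) (annihilation (orb r 0))
    (creation (orb p 0)) (creation (orb q 0)) (annihilation (orb s 1)) (annihilation (orb r 1))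
    (spinPlus_mul_creation_down_sub p) (spinPlus_mul_creation_down_sub q)
    (spinPlus_mul_creation_up_sub p) (spinPlus_mul_creation_up_sub q)
    (spinPlus_mul_annihilation_up_sub s) (spinPlus_mul_annihilation_up_sub r)
    (spinPlus_mul_annihilation_down_sub s) (spinPlus_mul_annihilation_down_sub r)
  have hexp := expect_doubleCommutator_spinPlus_eq_zero hP
    (spinMinus_spinMinus_mulVec_eq_zero_of_doublet hψ hP)
    (creation (orb p 1) * creation (orb q 1) * annihilation (orb s 0) * annihilation (orb r 0))
  rw [hop, two_nsmul, add_mulVec, dotProduct_add] at hexp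
  have h := add_self_eq_zero.1 hexp
  simpa only [twoRDM, Matrix.sub_mulVec, Matrix.add_mulVec, dotProduct_sub, dotProduct_add] using h

/-- **The rank-2 nullity rows are necessary for the DOUBLET spin class** `(b+1, b)`, `S = M = ½`: at the
RDM pair `(γ, Γ) = (¹D, ²D)` of every unit vector of the sector `(b+1, b)` annihilated by `Ŝ_+`, for all
spatial `p, q, r, s`,
`Γ^{pα qα}_{rα sα} + Γ^{pβ qβ}_{rβ sβ} − Γ^{pα qβ}_{rα sβ} − Γ^{pα qβ}_{rβ sα} − Γ^{pβ qα}_{rα sβ}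
  − Γ^{pβ qα}_{rβ sα} = 0`
— so these rows may be appended to ANY class-necessary condition set (`IsNecessaryInSpinClass.and`) and a
certificate of the augmented programme still bounds `E₀(Ĥ; b+1, b, S = ½)`
(`le_minEnergyOn_spinClass_of_forall_necessary`). [cite: HelgakerJorgensenOlsen2000, §2.3.1 eqs. (2.3.1)-(2.3.6)] -/
theorem isNecessaryInSpinClass_rankTwoNullity (b : ℕ) :
    IsNecessaryInSpinClass (Λ := Λ) (b + 1) b fun _ Γ =>
      ∀ p q r s : Λ, Γ (orb p 0, orb q 0) (orb r 0, orb s 0) + Γ (orb p 1, orb q 1) (orb r 1, orb s 1) -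
        Γ (orb p 0, orb q 1) (orb r 0, orb s 1) - Γ (orb p 0, orb q 1) (orb r 1, orb s 0) -
        Γ (orb p 1, orb q 0) (orb r 0, orb s 1) - Γ (orb p 1, orb q 0) (orb r 1, orb s 0) = 0 :=
  fun _ hψ hP _ p q r s => twoRDM_rankTwo_nullity_of_doublet hψ hP p q r s

/-- Instance: **sector `DQGT1T2′` + the rank-2 nullity rows** is necessary for the doublet class
`(b+1, b)` (the `DQGT1T2′ + Q2` part of a K14-PIN-R1 ARM-A programme; the maximal-projection rows are
appended Summit-side). [cite: NakataEtAl2008, §II.A-C] -/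
theorem isNecessaryInSpinClass_isDQGT1T2PrimeFeasibleSector_rankTwoNullity (b : ℕ) :
    IsNecessaryInSpinClass (Λ := Λ) (b + 1) b fun γ Γ => IsDQGT1T2PrimeFeasibleSector (b + 1) b γ Γ ∧
      ∀ p q r s : Λ, Γ (orb p 0, orb q 0) (orb r 0, orb s 0) + Γ (orb p 1, orb q 1) (orb r 1, orb s 1) -
        Γ (orb p 0, orb q 1) (orb r 0, orb s 1) - Γ (orb p 0, orb q 1) (orb r 1, orb s 0) -
        Γ (orb p 1, orb q 0) (orb r 0, orb s 1) - Γ (orb p 1, orb q 0) (orb r 1, orb s 0) = 0 :=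
  (isNecessaryInSector_isDQGT1T2PrimeFeasibleSector (b + 1) b).isNecessaryInSpinClass.and
    (isNecessaryInSpinClass_rankTwoNullity b)

end Literature.MathematicalPhysics.QuantumChemistry

end
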